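import Mathlib
import Summits.MatrixMultiplication.MatrixMultiplication.Theorems.ThinPackings.Negative.TriageRuledGraphPatternedArc

set_option linter.dupNamespace false

/-!
# Stub `stub_gradedFrames` — multi-radius orthogonal frames are label-weighted (Pythagoras)

Crux `stmt-MatrixMultiplication-10595` (`Theses.ThinBlockAlpha.ThinPackings`), line
`label-weighted-stpp-debordering`.

Blocks are multi-radius orthogonal frames in `ℤ^D`: within block `i` the three legs `A i`, `B i`,
`C i` are pointwise orthogonal and lie on the spheres of squared radii `xA + α·d i`, `xB − β·d i`,
`xC + γ·d i` (`d i` the grade of the block), with admissible slopes `0 ≤ α, γ`, `1 ≤ α + γ`,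
`α, γ < β`.  For such a family the label-weighted STPP `IsLabelWeightedSTPP A B C (−d) (−d)`
(potentials `κ = μ = −d`, so the weight of a pattern `(i, j, k)` is `2·d k − d i − d j`) is
EQUIVALENT to four residual clauses: the three packings (`C − A`, `B − A`, `B − C` tiles with unique
representation across blocks) and the all-distinct-label clause restricted to the non-convex triples
`2·d k ≤ d i + d j`.

`→` is bookkeeping (clauses (1)–(3) are the packings up to orientation; clause (5) with weight
`≤ 0` forbids the non-convex distinct relations).  `←`: the TPP of a block holds because the three
summands of a relation are pairwise orthogonal, hence all zero (`dotProduct_self_eq_zero`); for the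
two-label patterns a norm transfer (Pythagoras) gives `(α+γ)(d k − d i) = ‖t − t'‖²`
(pattern `(i,i,k)`), `(α−β)(d i − d k) = ‖u' − u‖²` (pattern `(i,k,k)`),
`(γ−β)(d j − d i) = ‖s − s'‖²` (pattern `(i,j,i)`); the right-hand side is either `0` — then the
relation is a tile collision between two distinct blocks, excluded by the matching packing — or
`≥ 1` by integrality, which forces the weight to be `≥ 1`; the all-distinct pattern is either
excluded (non-convex) or has weight `≥ 1` directly.

Main result: `stub_gradedFrames`.  Helpers (namespace `GradedFrames`): squared-norm facts in `ℤ^D`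
and the three two-label pattern lemmas `case_iik`, `case_ijj`, `case_iji`.
-/

namespace Summit.MatrixMultiplication.MatrixMultiplication.Theorems.ThinPackings

open Finset
open Literature.Computability.AlgebraicComplexity (IsSTPP)
open Summit.MatrixMultiplication.MatrixMultiplication.Theorems.ThinPackings.Negative.Triage2 (IsLabelWeightedSTPP)

/-- Squared norms in `ℤ^D` are nonnegative. -/
theorem GradedFrames.normSq_nonneg {D : ℕ} (v : Fin D → ℤ) : 0 ≤ v ⬝ᵥ v := by
  unfold dotProduct
  exact Finset.sum_nonneg fun i _ => mul_self_nonneg (v i)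

/-- A nonzero vector of `ℤ^D` has squared norm `≥ 1` (integrality). -/
theorem GradedFrames.one_le_normSq {D : ℕ} {v : Fin D → ℤ} (hv : v ≠ 0) : 1 ≤ v ⬝ᵥ v := by
  have h0 := GradedFrames.normSq_nonneg v
  have hne : v ⬝ᵥ v ≠ 0 := fun h => hv (dotProduct_self_eq_zero.mp h)
  omega

/-- Pythagoras for a difference of orthogonal vectors. -/
theorem GradedFrames.normSq_sub {D : ℕ} {p q : Fin D → ℤ} (h : p ⬝ᵥ q = 0) :
    (p - q) ⬝ᵥ (p - q) = p ⬝ᵥ p + q ⬝ᵥ q := by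
  rw [sub_dotProduct, dotProduct_sub, dotProduct_sub, dotProduct_comm q p, h]; ring

/-- Pythagoras for a sum of orthogonal vectors. -/
theorem GradedFrames.normSq_add {D : ℕ} {p q : Fin D → ℤ} (h : p ⬝ᵥ q = 0) :
    (p + q) ⬝ᵥ (p + q) = p ⬝ᵥ p + q ⬝ᵥ q := by
  rw [add_dotProduct, dotProduct_add, dotProduct_add, dotProduct_comm q p, h]; ring

/-- Two differences taken across two mutually orthogonal pairs of vectors are orthogonal. -/
theorem GradedFrames.sub_dotProduct_sub_eq_zero {D : ℕ} {a a' b b' : Fin D → ℤ}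
    (h1 : a ⬝ᵥ b = 0) (h2 : a ⬝ᵥ b' = 0) (h3 : a' ⬝ᵥ b = 0) (h4 : a' ⬝ᵥ b' = 0) :
    (a' - a) ⬝ᵥ (b' - b) = 0 := by
  simp [sub_dotProduct, dotProduct_sub, h1, h2, h3, h4]

/-- Three pairwise orthogonal vectors of `ℤ^D` summing to zero all vanish (the TPP of a frame). -/
theorem GradedFrames.eq_zero_of_orth_sum {D : ℕ} {p q r : Fin D → ℤ} (hpq : p ⬝ᵥ q = 0)
    (hpr : p ⬝ᵥ r = 0) (hqr : q ⬝ᵥ r = 0) (h : p + q + r = 0) : p = 0 ∧ q = 0 ∧ r = 0 := by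
  have hp : p ⬝ᵥ p = 0 := by
    have e : (p + q + r) ⬝ᵥ p = 0 := by rw [h, zero_dotProduct]
    rw [add_dotProduct, add_dotProduct, dotProduct_comm q p, dotProduct_comm r p, hpq, hpr] at e
    linarith
  have hq : q ⬝ᵥ q = 0 := by
    have e : (p + q + r) ⬝ᵥ q = 0 := by rw [h, zero_dotProduct]
    rw [add_dotProduct, add_dotProduct, hpq, dotProduct_comm r q, hqr] at e
    linarith
  have hr : r ⬝ᵥ r = 0 := by
    have e : (p + q + r) ⬝ᵥ r = 0 := by rw [h, zero_dotProduct]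
    rw [add_dotProduct, add_dotProduct, hpr, hqr] at e
    linarith
  exact ⟨dotProduct_self_eq_zero.mp hp, dotProduct_self_eq_zero.mp hq,
    dotProduct_self_eq_zero.mp hr⟩

/-- Norm transfer across a relation `e - f = (e' - f') + (g - g')` between two orthogonal pairs,
the difference `g - g'` being orthogonal to `e'` and `f'` (Pythagoras twice). -/
theorem GradedFrames.norm_transfer {D : ℕ} {e f e' f' g g' : Fin D → ℤ} (hef : e ⬝ᵥ f = 0)
    (hef' : e' ⬝ᵥ f' = 0) (h1 : e' ⬝ᵥ g = 0) (h2 : e' ⬝ᵥ g' = 0) (h3 : f' ⬝ᵥ g = 0)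
    (h4 : f' ⬝ᵥ g' = 0) (h : e - f = (e' - f') + (g - g')) :
    e ⬝ᵥ e + f ⬝ᵥ f = e' ⬝ᵥ e' + f' ⬝ᵥ f' + (g - g') ⬝ᵥ (g - g') := by
  have hx : (e' - f') ⬝ᵥ (g - g') = 0 := by
    simp [sub_dotProduct, dotProduct_sub, h1, h2, h3, h4]
  rw [← normSq_sub hef, h, normSq_add hx, normSq_sub hef']

/-- Pattern `(i, i, k)` with `i ≠ k`: a relation `(s' - s) + (t' - t) + (u' - u) = 0` with
`s ∈ A k`, `s', t, t', u` in block `i`, `u' ∈ C k` forces `d k ≥ d i + 1`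
(norm transfer `(α + γ)(d k − d i) = ‖t − t'‖²`, and `t = t'` would be a `C − A` tile collision). -/
theorem GradedFrames.case_iik {D L : ℕ} {A B C : Fin L → Finset (Fin D → ℤ)} {d : Fin L → ℤ}
    {xA xC α γ : ℤ} (hαγ : 1 ≤ α + γ)
    (hAB : ∀ i, ∀ x ∈ A i, ∀ y ∈ B i, x ⬝ᵥ y = 0) (hAC : ∀ i, ∀ x ∈ A i, ∀ z ∈ C i, x ⬝ᵥ z = 0)
    (hBC : ∀ i, ∀ y ∈ B i, ∀ z ∈ C i, y ⬝ᵥ z = 0)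
    (hnA : ∀ i, ∀ x ∈ A i, x ⬝ᵥ x = xA + α * d i) (hnC : ∀ i, ∀ z ∈ C i, z ⬝ᵥ z = xC + γ * d i)
    (R1 : ∀ i k, ∀ a ∈ A i, ∀ c ∈ C i, ∀ a' ∈ A k, ∀ c' ∈ C k,
      c - a = c' - a' → i = k ∧ a = a' ∧ c = c')
    {i k : Fin L} (hik : i ≠ k) {s s' t t' u u' : Fin D → ℤ} (hs : s ∈ A k) (hs' : s' ∈ A i)
    (ht : t ∈ B i) (ht' : t' ∈ B i) (hu : u ∈ C i) (hu' : u' ∈ C k)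
    (hrel : (s' - s) + (t' - t) + (u' - u) = 0) : 1 ≤ d k - d i := by
  have hvec : u' - s = (u - s') + (t - t') := by
    have e : u' - s = (u - s') + (t - t') + ((s' - s) + (t' - t) + (u' - u)) := by abel
    rw [e, hrel, add_zero]
  have key := norm_transfer (by rw [dotProduct_comm]; exact hAC k s hs u' hu')
    (by rw [dotProduct_comm]; exact hAC i s' hs' u hu)
    (by rw [dotProduct_comm]; exact hBC i t ht u hu)
    (by rw [dotProduct_comm]; exact hBC i t' ht' u hu) (hAB i s' hs' t ht) (hAB i s' hs' t' ht')
    hvec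
  rw [hnC k u' hu', hnA k s hs, hnC i u hu, hnA i s' hs'] at key
  by_cases htt : t = t'
  · subst htt
    have hcol : u - s' = u' - s := by rw [hvec, sub_self, add_zero]
    exact absurd (R1 i k s' hs' u hu s hs u' hu' hcol).1 hik
  · have hN := one_le_normSq (sub_ne_zero.mpr htt)
    have hprod : (α + γ) * (d k - d i) = (t - t') ⬝ᵥ (t - t') := by linear_combination key
    by_contra hlt
    have hle : (α + γ) * (d k - d i) ≤ 0 :=
      mul_nonpos_of_nonneg_of_nonpos (by linarith) (by omega)
    linarith

/-- Pattern `(i, k, k)` with `i ≠ k`: a relation with `s' ∈ A i`, `t ∈ B i` and `s, t', u, u'` in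
block `k` forces `d k ≥ d i + 1`
(norm transfer `(α − β)(d i − d k) = ‖u' − u‖²`, and `u = u'` would be a `B − A` tile collision). -/
theorem GradedFrames.case_ijj {D L : ℕ} {A B C : Fin L → Finset (Fin D → ℤ)} {d : Fin L → ℤ}
    {xA xB α β : ℤ} (hαβ : α < β)
    (hAB : ∀ i, ∀ x ∈ A i, ∀ y ∈ B i, x ⬝ᵥ y = 0) (hAC : ∀ i, ∀ x ∈ A i, ∀ z ∈ C i, x ⬝ᵥ z = 0)
    (hBC : ∀ i, ∀ y ∈ B i, ∀ z ∈ C i, y ⬝ᵥ z = 0)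
    (hnA : ∀ i, ∀ x ∈ A i, x ⬝ᵥ x = xA + α * d i) (hnB : ∀ i, ∀ y ∈ B i, y ⬝ᵥ y = xB - β * d i)
    (R2 : ∀ i k, ∀ a ∈ A i, ∀ b ∈ B i, ∀ a' ∈ A k, ∀ b' ∈ B k,
      b - a = b' - a' → i = k ∧ a = a' ∧ b = b')
    {i k : Fin L} (hik : i ≠ k) {s s' t t' u u' : Fin D → ℤ} (hs : s ∈ A k) (hs' : s' ∈ A i)
    (ht : t ∈ B i) (ht' : t' ∈ B k) (hu : u ∈ C k) (hu' : u' ∈ C k)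
    (hrel : (s' - s) + (t' - t) + (u' - u) = 0) : 1 ≤ d k - d i := by
  have hvec : t - s' = (t' - s) + (u' - u) := by
    have e : t - s' = (t' - s) + (u' - u) - ((s' - s) + (t' - t) + (u' - u)) := by abel
    rw [e, hrel, sub_zero]
  have key := norm_transfer (by rw [dotProduct_comm]; exact hAB i s' hs' t ht)
    (by rw [dotProduct_comm]; exact hAB k s hs t' ht') (hBC k t' ht' u' hu') (hBC k t' ht' u hu)
    (hAC k s hs u' hu') (hAC k s hs u hu) hvec
  rw [hnB i t ht, hnA i s' hs', hnB k t' ht', hnA k s hs] at key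
  by_cases huu : u' = u
  · subst huu
    have hcol : t - s' = t' - s := by rw [hvec, sub_self, add_zero]
    exact absurd (R2 i k s' hs' t ht s hs t' ht' hcol).1 hik
  · have hN := one_le_normSq (sub_ne_zero.mpr huu)
    have hprod : (α - β) * (d i - d k) = (u' - u) ⬝ᵥ (u' - u) := by linear_combination key
    by_contra hlt
    have hle : (α - β) * (d i - d k) ≤ 0 :=
      mul_nonpos_of_nonpos_of_nonneg (by linarith) (by omega)
    linarith

/-- Pattern `(i, j, i)` with `i ≠ j`: a relation with `s, s', t, u'` in block `i` and `t' ∈ B j`,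
`u ∈ C j` forces `d i ≥ d j + 1`
(norm transfer `(γ − β)(d j − d i) = ‖s − s'‖²`, and `s = s'` would be a `B − C` tile collision). -/
theorem GradedFrames.case_iji {D L : ℕ} {A B C : Fin L → Finset (Fin D → ℤ)} {d : Fin L → ℤ}
    {xB xC β γ : ℤ} (hγβ : γ < β)
    (hAB : ∀ i, ∀ x ∈ A i, ∀ y ∈ B i, x ⬝ᵥ y = 0) (hAC : ∀ i, ∀ x ∈ A i, ∀ z ∈ C i, x ⬝ᵥ z = 0)
    (hBC : ∀ i, ∀ y ∈ B i, ∀ z ∈ C i, y ⬝ᵥ z = 0)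
    (hnB : ∀ i, ∀ y ∈ B i, y ⬝ᵥ y = xB - β * d i) (hnC : ∀ i, ∀ z ∈ C i, z ⬝ᵥ z = xC + γ * d i)
    (R3 : ∀ i k, ∀ b ∈ B i, ∀ c ∈ C i, ∀ b' ∈ B k, ∀ c' ∈ C k,
      b - c = b' - c' → i = k ∧ b = b' ∧ c = c')
    {i j : Fin L} (hij : i ≠ j) {s s' t t' u u' : Fin D → ℤ} (hs : s ∈ A i) (hs' : s' ∈ A i)
    (ht : t ∈ B i) (ht' : t' ∈ B j) (hu : u ∈ C j) (hu' : u' ∈ C i)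
    (hrel : (s' - s) + (t' - t) + (u' - u) = 0) : 1 ≤ d i - d j := by
  have hvec : t' - u = (t - u') + (s - s') := by
    have e : t' - u = (t - u') + (s - s') + ((s' - s) + (t' - t) + (u' - u)) := by abel
    rw [e, hrel, add_zero]
  have key := norm_transfer (hBC j t' ht' u hu) (hBC i t ht u' hu')
    (by rw [dotProduct_comm]; exact hAB i s hs t ht)
    (by rw [dotProduct_comm]; exact hAB i s' hs' t ht)
    (by rw [dotProduct_comm]; exact hAC i s hs u' hu')
    (by rw [dotProduct_comm]; exact hAC i s' hs' u' hu') hvec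
  rw [hnB j t' ht', hnC j u hu, hnB i t ht, hnC i u' hu'] at key
  by_cases hss : s = s'
  · subst hss
    have hcol : t - u' = t' - u := by rw [hvec, sub_self, add_zero]
    exact absurd (R3 i j t ht u' hu' t' ht' u hu hcol).1 hij
  · have hN := one_le_normSq (sub_ne_zero.mpr hss)
    have hprod : (γ - β) * (d j - d i) = (s - s') ⬝ᵥ (s - s') := by linear_combination key
    by_contra hlt
    have hle : (γ - β) * (d j - d i) ≤ 0 :=
      mul_nonpos_of_nonpos_of_nonneg (by linarith) (by omega)
    linarith

/-- **stub_gradedFrames** — GRADED FRAMES ARE WEIGHTED.  For an orthogonal frame family in `ℤ^D`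
on graded spheres (squared radii `xA + α·d i`, `xB − β·d i`, `xC + γ·d i`) with admissible slopes
`0 ≤ α, γ`, `1 ≤ α + γ`, `α, γ < β`, the label-weighted STPP with potentials `κ = μ = −d` is
equivalent to the three packings together with the all-distinct-label clause restricted to the
non-convex triples `2·d k ≤ d i + d j`.  Multi-radius generalisation of the single-radius pair
collapse; the bridge of line `label-weighted-stpp-debordering` to the sphere designs.
[new, elementary: Pythagoras + integrality of squared norms] -/
theorem stub_gradedFrames :
    ∀ (D L : ℕ) (A B C : Fin L → Finset (Fin D → ℤ)) (d : Fin L → ℤ) (xA xB xC α β γ : ℤ),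
      (0 ≤ α ∧ 0 ≤ γ ∧ 1 ≤ α + γ ∧ α < β ∧ γ < β) →
      ((∀ i, ∀ x ∈ A i, ∀ y ∈ B i, x ⬝ᵥ y = 0) ∧ (∀ i, ∀ x ∈ A i, ∀ z ∈ C i, x ⬝ᵥ z = 0) ∧
        (∀ i, ∀ y ∈ B i, ∀ z ∈ C i, y ⬝ᵥ z = 0)) →
      ((∀ i, ∀ x ∈ A i, x ⬝ᵥ x = xA + α * d i) ∧ (∀ i, ∀ y ∈ B i, y ⬝ᵥ y = xB - β * d i) ∧
        (∀ i, ∀ z ∈ C i, z ⬝ᵥ z = xC + γ * d i)) →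
      (IsLabelWeightedSTPP A B C (fun i => -d i) (fun i => -d i) ↔
        ((∀ i k, ∀ a ∈ A i, ∀ c ∈ C i, ∀ a' ∈ A k, ∀ c' ∈ C k, c - a = c' - a' → i = k ∧ a = a' ∧ c = c') ∧
         (∀ i k, ∀ a ∈ A i, ∀ b ∈ B i, ∀ a' ∈ A k, ∀ b' ∈ B k, b - a = b' - a' → i = k ∧ a = a' ∧ b = b') ∧
         (∀ i k, ∀ b ∈ B i, ∀ c ∈ C i, ∀ b' ∈ B k, ∀ c' ∈ C k, b - c = b' - c' → i = k ∧ b = b' ∧ c = c') ∧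
         (∀ i j k : Fin L, i ≠ j → j ≠ k → i ≠ k → 2 * d k ≤ d i + d j →
            ∀ s ∈ A k, ∀ s' ∈ A i, ∀ t ∈ B i, ∀ t' ∈ B j, ∀ u ∈ C j, ∀ u' ∈ C k,
              (s' - s) + (t' - t) + (u' - u) ≠ 0))) := by
  intro D L A B C d xA xB xC α β γ hslope horth hnorm
  obtain ⟨-, -, hαγ, hαβ, hγβ⟩ := hslope
  obtain ⟨hAB, hAC, hBC⟩ := horth
  obtain ⟨hnA, hnB, hnC⟩ := hnorm
  constructor
  · rintro ⟨h1, h2, h3, -, h5⟩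
    refine ⟨?_, ?_, h2, ?_⟩
    · intro i k a ha c hc a' ha' c' hc' h
      obtain ⟨hik, hcc, haa⟩ := h3 i k c hc a ha c' hc' a' ha' h
      exact ⟨hik, haa, hcc⟩
    · intro i k a ha b hb a' ha' b' hb' h
      exact h1 i k a ha b hb a' ha' b' hb' (by rw [← neg_sub, h, neg_sub])
    · intro i j k hij _hjk _hik hd s hs s' hs' t ht t' ht' u hu u' hu' hrel
      have hw : 1 ≤ (-d i - -d k) + (-d j - -d k) :=
        h5 i j k (fun h => hij h.1) s hs s' hs' t ht t' ht' u hu u' hu' hrel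
      linarith
  · rintro ⟨R1, R2, R3, R4⟩
    refine ⟨?_, R3, ?_, ?_, ?_⟩
    · intro i k s hs t ht s' hs' t' ht' h
      exact R2 i k s hs t ht s' hs' t' ht' (by rw [← neg_sub, h, neg_sub])
    · intro i k u hu s hs u' hu' s' hs' h
      obtain ⟨hik, hss, huu⟩ := R1 i k s hs u hu s' hs' u' hu' h
      exact ⟨hik, huu, hss⟩
    · intro i s hs s' hs' t ht t' ht' u hu u' hu' hrel
      obtain ⟨hp, hq, hr⟩ := GradedFrames.eq_zero_of_orth_sum
        (GradedFrames.sub_dotProduct_sub_eq_zero (hAB i s hs t ht) (hAB i s hs t' ht')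
          (hAB i s' hs' t ht) (hAB i s' hs' t' ht'))
        (GradedFrames.sub_dotProduct_sub_eq_zero (hAC i s hs u hu) (hAC i s hs u' hu')
          (hAC i s' hs' u hu) (hAC i s' hs' u' hu'))
        (GradedFrames.sub_dotProduct_sub_eq_zero (hBC i t ht u hu) (hBC i t ht u' hu')
          (hBC i t' ht' u hu) (hBC i t' ht' u' hu')) hrel
      exact ⟨(sub_eq_zero.mp hp).symm, (sub_eq_zero.mp hq).symm, (sub_eq_zero.mp hr).symm⟩
    · intro i j k hne s hs s' hs' t ht t' ht' u hu u' hu' hrel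
      show 1 ≤ (-d i - -d k) + (-d j - -d k)
      by_cases hij : i = j
      · subst hij
        have key := GradedFrames.case_iik hαγ hAB hAC hBC hnA hnC R1 (fun h => hne ⟨rfl, h⟩)
          hs hs' ht ht' hu hu' hrel
        linarith
      · by_cases hjk : j = k
        · subst hjk
          have key := GradedFrames.case_ijj hαβ hAB hAC hBC hnA hnB R2 hij
            hs hs' ht ht' hu hu' hrel
          linarith
        · by_cases hik : i = k
          · subst hik
            have key := GradedFrames.case_iji hγβ hAB hAC hBC hnB hnC R3 hij
              hs hs' ht ht' hu hu' hrel
            linarith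
          · by_cases hd : 2 * d k ≤ d i + d j
            · exact absurd hrel (R4 i j k hij hjk hik hd s hs s' hs' t ht t' ht' u hu u' hu')
            · omega

end Summit.MatrixMultiplication.MatrixMultiplication.Theorems.ThinPackings
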